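import Summits.BirchSwinnertonDyer.BirchSwinnertonDyer.Theorems.ThetaPartnerAtTwoSignedTransportAtTwoImprimitiveCount
import Summits.BirchSwinnertonDyer.BirchSwinnertonDyer.Theorems.ByReductionTypeAtTwoTowerNoFiniteSubmoduleOfLayerPackage
import Summits.BirchSwinnertonDyer.BirchSwinnertonDyer.Theorems.ThetaPartnerAtTwoSignedTransportAtTwoResidualKummer
import Summits.BirchSwinnertonDyer.Rank1Residual.X2.NonPrimitiveQuotientCorank
import HarnessLib

/-!
# Input (Λ3) of the `Λ`-adic road to SURJ⁺@2 (item 23110 at every rank): the layers `Sel^ε(E/K_n)` have `ℤ_p`-corank `≤ λ(X^ε)`,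
# UNIFORMLY in `n`, for a torsion signed dual datum with `μ = 0` and `E(K)[p] = 0` — every number field, prime, `ℤ_p`-extension, sign

Routes `ResidualThetaTransportAtTwo` (RTT, crux r201 `ResidualLambdaFormulaNegDiscAtTwo`, stmt-BirchSwinnertonDyer-23110) /
`ThetaPartnerAtTwo` (K1 `stub_surj2`). Seat `prover-bsd-rtt-w4` (width w4 of keying brief (195)); `--supports stmt-BirchSwinnertonDyer-23110`.
THEOREMS ONLY (no definition, no named fact, no `sorry`).

WHY. The tower-vanishing lemma (`ResidualThetaLayer.TowerVanishing.forall_eq_zero_of_antitone_of_rank_le_of_smul_mem`, p645112) needs a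
UNIFORM bound on the ranks of the layers of the compact `+` Selmer tower; the rank of the compact group `𝔖^ε(E/K_n)` is the `ℤ_p`-corank
of the discrete `Sel^ε(E/K_n)`, and THIS FILE bounds the latter by `λ(X^ε)` with no control theorem: `Sel^ε(E/K_n) ↪ Sel^ε(E/K_∞)`
(the restriction `h_n` is injective when `E(K)[p] = 0`, `TowerHaMa.layerToInfty_injective_of_no_pTorsion`), coranks are monotone under
injections into a `p`-primary group with finite `p`-torsion (`NonPrimitiveQuotientCorank.zpCorank_le_of_injective`), and
`corank_{ℤ_p} Sel^ε(E/K_∞) = λ(X^ε)` for `X^ε` finitely generated torsion with `μ = 0`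
(`SignedTransportAtTwo.zpCorank_signedSelmerInfty_eq_lambda`).

* `zpCorank_signedSelmerLayer_le_lambda` — any `K`, `p`, `κ`, topological generator `γ`, `ε`, datum `D` (f.g. torsion, `μ = 0`),
  `E(K)[p] = 0`: `zpCorank (Sel^ε(E/K_n)) p ≤ λ(X^ε)` for every `n`;
* `zpCorank_signedSelmerLayer_le_lambda_of_goodSS` — `K = ℚ`, `p = 2`, `E` good supersingular at `2` (`E(ℚ)[2] = 0` by
  `SignedTransportAtTwo.eq_zero_of_two_nsmul_eq_zero_of_goodSS`).

HONEST FRAMING: closes nothing; BSD is not proved by any of this.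
References: [GreenbergLNM1716] §1 p. 60, §3 Lemma 3.1; [Kobayashi2003] Def. 1.1; [GreenbergVatsal2000] §2 Prop. (2.1).
-/

set_option autoImplicit false
-- D-0017: single-problem summit, so `Summit.BirchSwinnertonDyer.BirchSwinnertonDyer.…` repeats a namespace BY DESIGN.
set_option linter.dupNamespace false

noncomputable section

open scoped Classical AddSubgroup

universe u

namespace Summit.BirchSwinnertonDyer.BirchSwinnertonDyer.Theorems.ResidualThetaLayer.TowerVanishing

open NumberField WeierstrassCurve Literature.NumberTheory.EllipticCurves Literature.NumberTheory.EllipticCurves.ZpExtension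
  Literature.NumberTheory.EllipticCurves.Kobayashi2003
  Summit.BirchSwinnertonDyer.BirchSwinnertonDyer.Theorems.TowerHaMa
  Summit.BirchSwinnertonDyer.Rank1Residual.X2.NonPrimitiveQuotientCorank

variable {K : Type u} [Field K] [NumberField K] (W : WeierstrassCurve K) [W.IsElliptic] {p : ℕ} [Fact p.Prime]
  (κ : ZpExtension K p) (ε : ℤˣ) {γ : Field.absoluteGaloisGroup K}

/-- **`corank_{ℤ_p} Sel^ε(E/K_n) ≤ λ(X^ε)` for every layer `n`** — any number field `K`, prime `p`, `ℤ_p`-extension `κ` with topological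
generator `γ`, sign `ε`, and any signed dual datum `D` with `X^ε` finitely generated `Λ`-torsion and `μ = 0`, provided `E(K)[p] = 0`:
`Sel^ε(E/K_n)` embeds in `Sel^ε(E/K_∞)` (`layerToInfty` is injective), whose corank is `λ(X^ε)`.
[cite: GreenbergLNM1716, §1 p. 60 and §3 Lemma 3.1] [cite: Kobayashi2003, Def. 1.1] -/
theorem zpCorank_signedSelmerLayer_le_lambda (hγ : κ.IsTopGenerator γ) (hK : ∀ P : W.toAffine.Point, p • P = 0 → P = 0)
    (D : SignedSelmerDualData W κ γ ε) [Module.Finite (IwasawaAlgebra p) D.X]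
    (hT : Module.IsTorsion (IwasawaAlgebra p) D.X) (hμ : D.mu = 0) (n : ℕ) :
    zpCorank (signedSelmerLayer W κ ε n) p ≤ D.lambda := by
  -- the restriction `Sel^ε(E/K_n) → Sel^ε(E/K_∞)` as an additive map, injective since `E(K)[p] = 0`
  let r : signedSelmerLayer W κ ε n →+ signedSelmerInfty W κ ε :=
    ((W.layerToInfty κ n).comp (signedSelmerLayer W κ ε n).subtype).codRestrict (signedSelmerInfty W κ ε)
      fun x ↦ map_layerToInfty_signedSelmerLayer_le W κ ε n ⟨x, x.2, rfl⟩
  have hr_coe : ∀ x : signedSelmerLayer W κ ε n,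
      ((r x : signedSelmerInfty W κ ε) : W.subgroupH1 p κ.kerSubgroup) = W.layerToInfty κ n x := fun _ ↦ rfl
  have hr : Function.Injective r := fun x y h ↦
    Subtype.ext (layerToInfty_injective_of_no_pTorsion W κ hγ hK n (by rw [← hr_coe, ← hr_coe, h]))
  -- `Sel^ε(E/K_∞)` is `p`-primary with finite `p`-torsion
  haveI : Finite (↥(signedSelmerInfty W κ ε))[(p : ℤ)] :=
    SignedTransportAtTwo.finite_torsionBy_signedSelmerInfty W κ γ ε D hT hμ
  have hB : ∀ b : signedSelmerInfty W κ ε, ∃ k : ℕ, p ^ k • b = 0 :=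
    SignedTransportAtTwo.exists_pow_smul_signedSelmerInfty_eq_zero W κ ε
  calc zpCorank (signedSelmerLayer W κ ε n) p ≤ zpCorank (signedSelmerInfty W κ ε) p := zpCorank_le_of_injective r hr hB
    _ = D.lambda := SignedTransportAtTwo.zpCorank_signedSelmerInfty_eq_lambda W κ γ ε D hT hμ

/-- **At `p = 2` on the supersingular rows: `corank_{ℤ₂} Sel⁺(E/ℚ_n) ≤ λ⁺` for every layer `n` of every `ℤ₂`-extension.** For
`E/ℚ` globally minimal with good supersingular reduction at `2` (`E(ℚ)[2] = 0`), a topological generator `γ`, and a `+` dual datum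
with `X⁺` finitely generated torsion and `μ = 0` — input (Λ3) (uniformly bounded layer ranks) of the `Λ`-adic road to SURJ⁺@2.
[cite: GreenbergVatsal2000, §2 Prop. (2.1)] [cite: GreenbergLNM1716, §1 p. 60] -/
theorem zpCorank_signedSelmerLayer_le_lambda_of_goodSS {E : WeierstrassCurve ℚ} [E.IsElliptic] [E.IsGloballyMinimal]
    (hss : Literature.NumberTheory.EllipticCurves.Rank1Residual.GoodSS E 2) (κ : ZpExtension ℚ 2)
    {γ : Field.absoluteGaloisGroup ℚ} (hγ : κ.IsTopGenerator γ) (D : SignedSelmerDualData E κ γ 1)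
    [Module.Finite (IwasawaAlgebra 2) D.X] (hT : Module.IsTorsion (IwasawaAlgebra 2) D.X) (hμ : D.mu = 0) (n : ℕ) :
    zpCorank (signedSelmerLayer E κ 1 n) 2 ≤ D.lambda :=
  zpCorank_signedSelmerLayer_le_lambda (p := 2) E κ 1 hγ
    (fun P hP ↦ SignedTransportAtTwo.eq_zero_of_two_nsmul_eq_zero_of_goodSS E hss P (by convert hP)) D hT hμ n

end Summit.BirchSwinnertonDyer.BirchSwinnertonDyer.Theorems.ResidualThetaLayer.TowerVanishing

end
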